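import Literature.Analysis.FluidPDE.ClassicalSolutionRegion
import Literature.Analysis.FluidPDE.SelfSimilar
import HarnessLib

/-!
# No Type I blow-up if nearly self-similar on one time slice (Pineau–Vicol 2026, Thm. 1.9)

Analysis/FluidPDE named-fact file. B. Pineau, V. Vicol, *On rotated backwards self-similar solutions
of the incompressible 3D Navier–Stokes equations*, arXiv:2607.09619 (2026), §1.5, **Theorem 1.9**
(p. 8 of the text; held: paper:arxiv-2607.09619). Bib key `PineauVicol2026`. Companion of
`PineauVicolRSS.lean` (Thms. 1.4, 1.7: the global RSS / RDSS Liouville theorems).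

**Theorem 1.9** (Approximately self-similar Type I solutions are regular; verbatim): "Let `(u, p)` be
a smooth solution to (1.1) on `B₁ × [−1,0)` satisfying the Type I bound
`|u(x,t)| ≤ C_u/(√(−t) + |x|)`, `(x,t) ∈ B₁ × [−1,0)` (1.15), for some constant `C_u > 0`. Assume
that the pressure is bounded far from `(0,0)`; that is, assume there exists a constant `C_p > 0`
such that the pressure satisfies the bound `|p(x,t)| ≤ C_p`, `(x,t) ∈ A × [−1,0)`,
`A := {1/2 < |x| < 3/4}` (1.16). There exist `δ₀ = δ₀(C_u) ∈ (0,1]` and `s₀ = s₀(C_u, C_p) ≥ 1`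
such that if, at a single time `t̄ ∈ (−e^{−s₀}, 0)` we have the bound
`‖√(−t̄) ((−t̄) ∂ₜu(·,t̄) − ½ u(·,t̄) − ½ (x·∇)u(·,t̄))‖_{L^∞(B₁)} ≤ δ₀` (1.17), then `(0,0)` is a
regular point." Footnote 12: "We say that `(0,0)` is a regular point of the solution `u` of (1.1)
if `u ∈ L^∞(B_r × (−r², 0))` for some `r > 0`, cf. [CKN]." (Remark 1.10: the operator
`(−t)∂ₜ − ½ − ½ x·∇` is `−½` times the generator of the self-similar scaling, so (1.17) measures the
deviation from backward self-similarity on one slice; Remark 1.11: a weighted-`L¹` form suffices.)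

**Vendored** as `pineauVicol2026_oneSlice_regularity`, over `IsClassicalNSSolutionOnRegion`
(`ClassicalSolutionRegion.lean`: `u`, `p` jointly `C^∞` on the region, the equations pointwise with
the time derivative `timeDerivOn` taken within the region — for the region
`Ω = [−1,0) × B₁` this is the genuine `∂ₜ` at every `−1 < t < 0` and the right derivative at
`t = −1`; the printed "smooth solution on `B₁ × [−1,0)`"), `(x·∇)u = fderiv ℝ (u t) x x`
(= `convect id`-type directional derivative along `x`), and the footnote's regular-point notion
written out (`‖u‖ ≤ M` on `B_r × (−r²,0)`; for a smooth `u` the essential and the plain supremum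
agree). Quantifier order as printed: `δ₀` depends on `C_u` only, `s₀` on `(C_u, C_p)`. The `L^∞(B₁)`
norm in (1.17) is rendered as a pointwise bound on the open unit ball (equal to the sup for the
continuous integrand). Nothing is asserted about the size of `δ₀`, `s₀` beyond `0 < δ₀ ≤ 1 ≤ s₀`.

Grounding role: nearest printed NS statement of the type "closeness to self-similarity at ONE time
forces rigidity" for Type-I solutions — recorded against
`Summit.NavierStokesRegularity.NavierStokesRegularity.Theses.DulacContraction.SynchronizationModSimilarity`
(stmt-NavierStokesRegularity-8559, whose `u = 0` rung is a one-slice weighted-`L²` ε-regularity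
claim) and the route's CHEAPEST FALSIFIER (3); it does NOT imply that item (different hypothesis:
`∂ₛU` small, not two profiles close modulo similarities; different conclusion: regularity, not
exponential synchronisation). Also relevant to route RecurrentProfiles (recurrent Type-I profiles).

## References

* B. Pineau, V. Vicol, arXiv:2607.09619 (2026), §1.5: (1.15)–(1.19), **Theorem 1.9**, Remarks
  1.10–1.11, footnote 12 (p. 8); proof in §9. [PineauVicol2026]
* L. Caffarelli, R. Kohn, L. Nirenberg, Comm. Pure Appl. Math. 35 (1982) (regular points). [CKN1982]
-/

noncomputable section

open MeasureTheory Set Metric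

namespace Literature.Analysis.FluidPDE

/-- Local notation for physical space `ℝ³ = EuclideanSpace ℝ (Fin 3)`. -/
local notation "ℝ³" => EuclideanSpace ℝ (Fin 3)

/-- **Pineau–Vicol 2026, Theorem 1.9 (approximately self-similar Type I solutions are regular).**
For every `C_u > 0` there is `δ₀ ∈ (0, 1]`, and for every `C_p > 0` there is `s₀ ≥ 1`, such that:
if `(u, p)` is a classical solution of Navier–Stokes (`ν = 1`, `f = 0`) on the space–time region
`[−1, 0) × B₁` with the Type I bound `‖u(t,x)‖ ≤ C_u/(√(−t) + ‖x‖)` there (1.15) and the pressure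
bound `|p(t,x)| ≤ C_p` for `1/2 < ‖x‖ < 3/4`, `−1 ≤ t < 0` (1.16), and if at ONE time
`t̄ ∈ (−e^{−s₀}, 0)` the self-similar time derivative is small on the unit ball,
`‖√(−t̄) • ((−t̄) • ∂ₜu(t̄,x) − ½ u(t̄,x) − ½ Du(t̄,x)[x])‖ ≤ δ₀` for all `‖x‖ < 1` (1.17), then
`(0,0)` is a regular point: `u` is bounded on `B_r × (−r², 0)` for some `r > 0` (footnote 12). [cite: PineauVicol2026, Theorem 1.9 (arXiv:2607.09619 p. 8)] -/
def pineauVicol2026_oneSlice_regularity : Prop :=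
  ∀ Cu : ℝ, 0 < Cu → ∃ δ₀ : ℝ, 0 < δ₀ ∧ δ₀ ≤ 1 ∧ ∀ Cp : ℝ, 0 < Cp → ∃ s₀ : ℝ, 1 ≤ s₀ ∧
    ∀ (u : ℝ → ℝ³ → ℝ³) (p : ℝ → ℝ³ → ℝ),
      IsClassicalNSSolutionOnRegion (Ico (-1 : ℝ) 0 ×ˢ ball (0 : ℝ³) 1) 1 0 u p →
      (∀ t ∈ Ico (-1 : ℝ) 0, ∀ x ∈ ball (0 : ℝ³) 1, ‖u t x‖ ≤ Cu / (Real.sqrt (-t) + ‖x‖)) →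
      (∀ t ∈ Ico (-1 : ℝ) 0, ∀ x : ℝ³, 1 / 2 < ‖x‖ → ‖x‖ < 3 / 4 → |p t x| ≤ Cp) →
      ∀ tbar : ℝ, -Real.exp (-s₀) < tbar → tbar < 0 →
        (∀ x ∈ ball (0 : ℝ³) 1,
          ‖Real.sqrt (-tbar) •
              ((-tbar) • timeDerivOn (Ico (-1 : ℝ) 0 ×ˢ ball (0 : ℝ³) 1) u tbar x
                - (1 / 2 : ℝ) • u tbar x - (1 / 2 : ℝ) • fderiv ℝ (u tbar) x x)‖ ≤ δ₀) →
        ∃ r : ℝ, 0 < r ∧ ∃ M : ℝ, ∀ t : ℝ, -r ^ 2 < t → t < 0 → ∀ x ∈ ball (0 : ℝ³) r, ‖u t x‖ ≤ M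

/-- The conclusion of Theorem 1.9 in the tree's vocabulary: boundedness on some `B_r × (−r², 0)`
makes `(0, 0)` NOT a backward singular point in the sense of Albritton–Barker
(`IsBackwardSingularPoint`, `LocalTypeI.lean`) — recorded informally here; the formal bridge
(pointwise bound ⇒ `eLpNorm ⊤ < ∞` on the parabolic cylinder) is left to the consumer. This lemma
only repackages the radius: a bound on `B_r × (−r²,0)` gives one on every smaller cylinder. [folklore] -/
theorem pineauVicol2026_oneSlice_regularity.mono_radius {u : ℝ → ℝ³ → ℝ³} {r r' M : ℝ}
    (hr' : 0 < r') (hle : r' ≤ r)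
    (h : ∀ t : ℝ, -r ^ 2 < t → t < 0 → ∀ x ∈ ball (0 : ℝ³) r, ‖u t x‖ ≤ M) :
    ∀ t : ℝ, -r' ^ 2 < t → t < 0 → ∀ x ∈ ball (0 : ℝ³) r', ‖u t x‖ ≤ M := by
  intro t ht1 ht2 x hx
  refine h t (lt_of_le_of_lt ?_ ht1) ht2 x (ball_subset_ball hle hx)
  have : r' ^ 2 ≤ r ^ 2 := pow_le_pow_left₀ hr'.le hle 2
  linarith

end Literature.Analysis.FluidPDE

end
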